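import Mathlib
import Summits.Ventures.PercRepro.TriangleCapTwoTrianglesA

/-!
# PercRepro — the two-triangle case of the dense-corner stability below `k = 10`, part B: a vertex off both
triangles with two distinct neighbours in them (p3, gen 35; part 35b)

Two triangles `u v w` and `a b c` (`a ∉ {u, v, w}`) of a `K₄⁻`-free graph in which every triangle vertex lies in
`S = {u, v, w, a, b, c}`.

* `adj_of_not_outer` — a vertex that is not outer is adjacent to one of the three; the `or3_of_or6_…` helpers;
* `at_most_one_of_triangle`, `not_adj_two_of_triangle` — a vertex off a triangle is adjacent to at most one
  of its vertices; `exists_nonadj_of_triangle` — two vertices off a triangle miss a common vertex of it;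
* `codeg_eq_zero_of_no_triangle` — a pair at a vertex lying on no triangle has `codeg = 0`;
* `four_le_sum_codeg_zero` — two distinct `codeg = 0` pairs at `r` with positive deficits give
  `Σ_{codeg = 0} deficit ≥ 4`;
* **`four_le_of_two_nbrs`** — this happens when some `r ∉ S` has two distinct neighbours in `S` (they lie in
  different triangles; the deficit of `(r, y)` sees the vertex of the other triangle adjacent to neither end).

Part C (TriangleCapTwoTrianglesC) treats the remaining case, every vertex off `S` hanging on one vertex.
Axioms: standard.
-/

namespace PercRepro

namespace TriangleCap

namespace C047

open Finset

variable {V : Type*} [Fintype V] [DecidableEq V]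

omit [DecidableEq V] in
/-- A vertex that is not outer is adjacent to one of the three. -/
theorem adj_of_not_outer (D : SimpleGraph V) [DecidableRel D.Adj] {u v w r : V} (h : r ∉ outer D u v w) :
    D.Adj u r ∨ D.Adj v r ∨ D.Adj w r := by
  by_cases hu : D.Adj u r
  · exact Or.inl hu
  by_cases hv : D.Adj v r
  · exact Or.inr (Or.inl hv)
  by_cases hw : D.Adj w r
  · exact Or.inr (Or.inr hw)
  exact (h ((mem_outer D u v w r).mpr ⟨hu, hv, hw⟩)).elim

/-- A three-way disjunction from a six-way one whose other half fails. -/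
theorem or3_of_or6_right {P₁ P₂ P₃ Q₁ Q₂ Q₃ : Prop} (h : P₁ ∨ P₂ ∨ P₃ ∨ Q₁ ∨ Q₂ ∨ Q₃)
    (hn : ¬ (P₁ ∨ P₂ ∨ P₃)) : Q₁ ∨ Q₂ ∨ Q₃ := by tauto

/-- A three-way disjunction from a six-way one whose other half fails. -/
theorem or3_of_or6_left {P₁ P₂ P₃ Q₁ Q₂ Q₃ : Prop} (h : P₁ ∨ P₂ ∨ P₃ ∨ Q₁ ∨ Q₂ ∨ Q₃)
    (hn : ¬ (Q₁ ∨ Q₂ ∨ Q₃)) : P₁ ∨ P₂ ∨ P₃ := by tauto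

/-- The left half of a six-way disjunction. -/
theorem or6_of_or3_left {P₁ P₂ P₃ Q₁ Q₂ Q₃ : Prop} (h : P₁ ∨ P₂ ∨ P₃) :
    P₁ ∨ P₂ ∨ P₃ ∨ Q₁ ∨ Q₂ ∨ Q₃ := by tauto

/-- The right half of a six-way disjunction. -/
theorem or6_of_or3_right {P₁ P₂ P₃ Q₁ Q₂ Q₃ : Prop} (h : Q₁ ∨ Q₂ ∨ Q₃) :
    P₁ ∨ P₂ ∨ P₃ ∨ Q₁ ∨ Q₂ ∨ Q₃ := by tauto

/-- A vertex off a triangle of a `K₄⁻`-free graph is adjacent to at most one of its three vertices. -/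
theorem at_most_one_of_triangle (D : SimpleGraph V) [DecidableRel D.Adj] (hK : K4mFree D) {p q s x : V}
    (hpq : D.Adj p q) (hps : D.Adj p s) (hqs : D.Adj q s) (hx : ¬ (x = p ∨ x = q ∨ x = s)) :
    ¬ (D.Adj p x ∧ D.Adj q x) ∧ ¬ (D.Adj p x ∧ D.Adj s x) ∧ ¬ (D.Adj q x ∧ D.Adj s x) := by
  have hxp : x ≠ p := fun h => hx (Or.inl h)
  have hxq : x ≠ q := fun h => hx (Or.inr (Or.inl h))
  have hxs : x ≠ s := fun h => hx (Or.inr (Or.inr h))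
  exact ⟨fun h => not_adj_both D hK hpq hps hqs (Ne.symm hxs) h.1 h.2,
    fun h => not_adj_both D hK hps hpq hqs.symm (Ne.symm hxq) h.1 h.2,
    fun h => not_adj_both D hK hqs hpq.symm hps.symm (Ne.symm hxp) h.1 h.2⟩

/-- A vertex off a triangle is not adjacent to two distinct vertices of it. -/
theorem not_adj_two_of_triangle (D : SimpleGraph V) [DecidableRel D.Adj] (hK : K4mFree D) {p q s x y₁ y₂ : V}
    (hpq : D.Adj p q) (hps : D.Adj p s) (hqs : D.Adj q s) (hx : ¬ (x = p ∨ x = q ∨ x = s))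
    (h1 : y₁ = p ∨ y₁ = q ∨ y₁ = s) (h2 : y₂ = p ∨ y₂ = q ∨ y₂ = s) (h12 : y₁ ≠ y₂)
    (hx1 : D.Adj x y₁) (hx2 : D.Adj x y₂) : False := by
  obtain ⟨g1, g2, g3⟩ := at_most_one_of_triangle D hK hpq hps hqs hx
  rcases h1 with rfl | rfl | rfl <;> rcases h2 with rfl | rfl | rfl
  · exact h12 rfl
  · exact g1 ⟨hx1.symm, hx2.symm⟩
  · exact g2 ⟨hx1.symm, hx2.symm⟩
  · exact g1 ⟨hx2.symm, hx1.symm⟩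
  · exact h12 rfl
  · exact g3 ⟨hx1.symm, hx2.symm⟩
  · exact g2 ⟨hx2.symm, hx1.symm⟩
  · exact g3 ⟨hx2.symm, hx1.symm⟩
  · exact h12 rfl

/-- Two vertices off a triangle miss a common vertex of it. -/
theorem exists_nonadj_of_triangle (D : SimpleGraph V) [DecidableRel D.Adj] (hK : K4mFree D) {p q s : V}
    (hpq : D.Adj p q) (hps : D.Adj p s) (hqs : D.Adj q s) {r y : V} (hr : ¬ (r = p ∨ r = q ∨ r = s))
    (hy : ¬ (y = p ∨ y = q ∨ y = s)) : ∃ z, ¬ D.Adj r z ∧ ¬ D.Adj y z := by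
  obtain ⟨h1, h2, h3⟩ := at_most_one_of_triangle D hK hpq hps hqs hr
  obtain ⟨g1, g2, g3⟩ := at_most_one_of_triangle D hK hpq hps hqs hy
  by_cases hrp : D.Adj p r <;> by_cases hrq : D.Adj q r <;> by_cases hrs : D.Adj s r <;>
    by_cases hyp : D.Adj p y <;> by_cases hyq : D.Adj q y <;> by_cases hys : D.Adj s y
  all_goals first
    | exact (h1 ⟨hrp, hrq⟩).elim
    | exact (h2 ⟨hrp, hrs⟩).elim
    | exact (h3 ⟨hrq, hrs⟩).elim
    | exact (g1 ⟨hyp, hyq⟩).elim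
    | exact (g2 ⟨hyp, hys⟩).elim
    | exact (g3 ⟨hyq, hys⟩).elim
    | exact ⟨p, fun h => hrp h.symm, fun h => hyp h.symm⟩
    | exact ⟨q, fun h => hrq h.symm, fun h => hyq h.symm⟩
    | exact ⟨s, fun h => hrs h.symm, fun h => hys h.symm⟩

omit [DecidableEq V] in
/-- A pair at a vertex lying on no triangle has `codeg = 0`. -/
theorem codeg_eq_zero_of_no_triangle (D : SimpleGraph V) [DecidableRel D.Adj] {r y : V}
    (hry : D.Adj r y) (hr : ∀ x z, D.Adj r x → D.Adj r z → D.Adj x z → False) : codeg D (r, y) = 0 := by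
  unfold codeg
  rw [card_eq_zero, filter_eq_empty_iff]
  intro x _ hx
  exact hr y x hry hx.1 hx.2

/-- Two distinct `codeg = 0` pairs at `r` with positive deficits give `Σ_{codeg = 0} deficit ≥ 4`. -/
theorem four_le_sum_codeg_zero (D : SimpleGraph V) [DecidableRel D.Adj] {r y₁ y₂ : V} (h12 : y₁ ≠ y₂)
    (hry₁ : D.Adj r y₁) (hry₂ : D.Adj r y₂) (hc₁ : codeg D (r, y₁) = 0) (hc₂ : codeg D (r, y₂) = 0)
    (hd₁ : 1 ≤ deficit D (r, y₁)) (hd₂ : 1 ≤ deficit D (r, y₂)) :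
    4 ≤ ∑ p ∈ adjPairsAll D, (if codeg D p = 0 then deficit D p else 0) := by
  set P : Finset (V × V) := {(r, y₁), (y₁, r), (r, y₂), (y₂, r)} with hP
  have hsub : P ⊆ adjPairsAll D := by
    intro p hp
    rw [hP] at hp
    simp only [mem_insert, mem_singleton] at hp
    rw [mem_adjPairsAll]
    rcases hp with rfl | rfl | rfl | rfl
    · exact hry₁
    · exact hry₁.symm
    · exact hry₂
    · exact hry₂.symm
  have hc₁' : codeg D (y₁, r) = 0 := by rw [codeg_comm]; exact hc₁
  have hc₂' : codeg D (y₂, r) = 0 := by rw [codeg_comm]; exact hc₂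
  have hd₁' : 1 ≤ deficit D (y₁, r) := by rw [deficit_comm]; exact hd₁
  have hd₂' : 1 ≤ deficit D (y₂, r) := by rw [deficit_comm]; exact hd₂
  have hpos : ∀ p ∈ P, 1 ≤ (if codeg D p = 0 then deficit D p else 0) := by
    intro p hp
    rw [hP] at hp
    simp only [mem_insert, mem_singleton] at hp
    rcases hp with rfl | rfl | rfl | rfl
    · rw [if_pos hc₁]; exact hd₁
    · rw [if_pos hc₁']; exact hd₁'
    · rw [if_pos hc₂]; exact hd₂
    · rw [if_pos hc₂']; exact hd₂'
  have hcard : P.card = 4 := by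
    rw [hP, card_insert_of_notMem, card_insert_of_notMem, card_insert_of_notMem, card_singleton]
    all_goals simp [hry₁.ne, hry₂.ne, hry₁.ne.symm, hry₂.ne.symm, h12]
  calc 4 = ∑ _p ∈ P, 1 := by rw [sum_const, hcard]; rfl
    _ ≤ ∑ p ∈ P, (if codeg D p = 0 then deficit D p else 0) := sum_le_sum hpos
    _ ≤ ∑ p ∈ adjPairsAll D, (if codeg D p = 0 then deficit D p else 0) := sum_le_sum_of_subset hsub

/-- **TWO DISTINCT NEIGHBOURS IN `S`:** if some `r ∉ S` is adjacent to two distinct vertices of `S`, then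
`Σ_{codeg = 0} deficit ≥ 4`. -/
theorem four_le_of_two_nbrs (D : SimpleGraph V) [DecidableRel D.Adj] (hK : K4mFree D) {u v w a b c : V}
    (huv : D.Adj u v) (huw : D.Adj u w) (hvw : D.Adj v w) (hab : D.Adj a b) (hac : D.Adj a c)
    (hbc : D.Adj b c)
    (hS : ∀ x y z, D.Adj x y → D.Adj x z → D.Adj y z → x = u ∨ x = v ∨ x = w ∨ x = a ∨ x = b ∨ x = c)
    {r y₁ y₂ : V} (hr : ¬ (r = u ∨ r = v ∨ r = w ∨ r = a ∨ r = b ∨ r = c))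
    (hy₁ : y₁ = u ∨ y₁ = v ∨ y₁ = w ∨ y₁ = a ∨ y₁ = b ∨ y₁ = c)
    (hy₂ : y₂ = u ∨ y₂ = v ∨ y₂ = w ∨ y₂ = a ∨ y₂ = b ∨ y₂ = c) (h12 : y₁ ≠ y₂)
    (hry₁ : D.Adj r y₁) (hry₂ : D.Adj r y₂) :
    4 ≤ ∑ p ∈ adjPairsAll D, (if codeg D p = 0 then deficit D p else 0) := by
  have hr1 : ¬ (r = u ∨ r = v ∨ r = w) := fun h => hr (or6_of_or3_left h)
  have hr2 : ¬ (r = a ∨ r = b ∨ r = c) := fun h => hr (or6_of_or3_right h)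
  have hno : ∀ x z, D.Adj r x → D.Adj r z → D.Adj x z → False := fun x z h1 h2 h3 => hr (hS r x z h1 h2 h3)
  have hc₁ := codeg_eq_zero_of_no_triangle D hry₁ hno
  have hc₂ := codeg_eq_zero_of_no_triangle D hry₂ hno
  -- not both in the same triangle
  have hn1 : ¬ ((y₁ = u ∨ y₁ = v ∨ y₁ = w) ∧ (y₂ = u ∨ y₂ = v ∨ y₂ = w)) := fun h =>
    not_adj_two_of_triangle D hK huv huw hvw hr1 h.1 h.2 h12 hry₁ hry₂
  have hn2 : ¬ ((y₁ = a ∨ y₁ = b ∨ y₁ = c) ∧ (y₂ = a ∨ y₂ = b ∨ y₂ = c)) := fun h =>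
    not_adj_two_of_triangle D hK hab hac hbc hr2 h.1 h.2 h12 hry₁ hry₂
  -- the deficit of `(r, y)` with `r, y` off a triangle
  have key : ∀ y, D.Adj r y → ¬ (y = u ∨ y = v ∨ y = w) → 1 ≤ deficit D (r, y) := by
    intro y _ hy
    obtain ⟨z, hz1, hz2⟩ := exists_nonadj_of_triangle D hK huv huw hvw hr1 hy
    exact one_le_deficit D hz1 hz2
  have key' : ∀ y, D.Adj r y → ¬ (y = a ∨ y = b ∨ y = c) → 1 ≤ deficit D (r, y) := by
    intro y _ hy
    obtain ⟨z, hz1, hz2⟩ := exists_nonadj_of_triangle D hK hab hac hbc hr2 hy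
    exact one_le_deficit D hz1 hz2
  by_cases h1 : y₁ = u ∨ y₁ = v ∨ y₁ = w
  · have h2 : ¬ (y₂ = u ∨ y₂ = v ∨ y₂ = w) := fun h => hn1 ⟨h1, h⟩
    have h2' : y₂ = a ∨ y₂ = b ∨ y₂ = c := or3_of_or6_right hy₂ h2
    have h1' : ¬ (y₁ = a ∨ y₁ = b ∨ y₁ = c) := fun h => hn2 ⟨h, h2'⟩
    exact four_le_sum_codeg_zero D h12 hry₁ hry₂ hc₁ hc₂ (key' y₁ hry₁ h1') (key y₂ hry₂ h2)
  · have h1' : y₁ = a ∨ y₁ = b ∨ y₁ = c := or3_of_or6_right hy₁ h1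
    have h2 : ¬ (y₂ = a ∨ y₂ = b ∨ y₂ = c) := fun h => hn2 ⟨h1', h⟩
    have h2' : y₂ = u ∨ y₂ = v ∨ y₂ = w := or3_of_or6_left hy₂ h2
    exact four_le_sum_codeg_zero D h12 hry₁ hry₂ hc₁ hc₂ (key y₁ hry₁ h1) (key' y₂ hry₂ h2)

end C047

end TriangleCap

end PercRepro
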